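import Mathlib
import HarnessLib
import Summits.Ventures.LatticeQCDFlow.Exactness.NCMCGeneralSpaceDoeblinPowerCLT
import Summits.Ventures.LatticeQCDFlow.Exactness.NCMCGeneralSpaceGammaMethodStudentizedCLT
import Summits.Ventures.LatticeQCDFlow.Exactness.NCMCGeneralSpaceReplicaVectorCLT

/-!
# The replica VECTOR is asymptotically a product Gaussian, so the between-replica spread `n Σ_r (ȳ_r − ȳ̄)²` has the non-degenerate limit law `Σ_r (Z_r − Z̄)²`, `Z ~ N(0, σ²_f)^{⊗R}` — at fixed `R` the replica-jackknife error bar does NOT converge to a constant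

HONEST FRAMING: exact (Metropolis-corrected) sampling algorithms for lattice gauge theory;
figures of merit are autocorrelation/cost numbers at stated couplings and volumes; no
continuum-physics claim.

Venture `LatticeQCDFlow` (cell pub-lqcd), topic `Exactness`; FANOUT row 13 (`eng-snf`, GEN-23).
NEW WORK of the cell (against Mathlib's characteristic functions on the Euclidean space
`PiLp 2 (ι → ℝ)`, `MeasureTheory.charFun_pi`, and Lévy's continuity theorem; the second Gaussian moment is
imported from `Literature/Probability/Distributions/GaussianWidthStatDist`; the per-replica CLT is GEN-19's
`tendstoInDistribution_timeAverage_of_nHit` with GEN-20's `cltVariance_eq_autocov`, so this file does not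
depend on the pooled-CLT file), not a published result;
no definition is introduced; nothing is cited as a fact (the delete-one-replica jackknife / "many short
chains" error bar and its `χ²_{R−1}` / Student-`t_{R−1}` calibration — e.g. Gelman–Rubin 1992 — are
NAMED ONLY).  WHY (row 13): `latflow-snf`'s `estimators.free_energy` reports, along correlated starts,
a JACKKNIFE over `≥ 10` replicas / blocks (`snf/estimators.py`, `jackknife(stat, n, blocks)`), i.e. an
error bar built from the SPREAD of the `R` replica estimates, not from a Γ-method window.  GEN-23's
pooled Γ-method files show the windowed bar is consistent; THIS file types what the spread-based bar
does at FIXED `R`: the vector of normalised replica means `(√n (ȳ_{r,n} − πf))_r` converges JOINTLY to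
the product Gaussian `N(0, σ²_f)^{⊗R}` (independent factors each obeying GEN-19's CLT; joint
characteristic function = product, `charFun_pi`), hence by the continuous mapping theorem the
between-replica sum of squares `n Σ_r (ȳ_{r,n} − ȳ̄_n)²` converges in distribution to `Σ_r (Z_r − Z̄)²`
and the squared replica standard error `ŝe²_n = Σ_r (ȳ_r − ȳ̄)²/(R(R−1))` (= the delete-one jackknife
variance of the pooled mean) satisfies `n ŝe²_n ⇒ Σ_r (Z_r − Z̄)²/(R(R−1))` — a RANDOM limit (the
`σ²_f χ²_{R−1}/(R(R−1))` law, not named as such here), whereas the pooled Γ-method statistic divided by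
`R` converges to the CONSTANT `σ²_f/R`.

## Content (the generic half — joint limit of independent coordinates in `EuclideanSpace ℝ ι`, moments of
`Σ_r (Z_r − Z̄)²` under the product Gaussian — is `NCMCGeneralSpaceReplicaVectorCLT`)

* **`tendstoInDistribution_replicaVector_of_nHit`** — chain replicas from ANY starts:
  `((√n)⁻¹ Σ_{t<n} (f(x^r_t) − πf))_r ⇒ N(0, σ²_f)^{⊗R}`.
* **`tendstoInDistribution_betweenReplicaSS_of_nHit`** — `n Σ_r (ȳ_{r,n} − ȳ̄_n)² ⇒ Σ_r (Z_r − Z̄)²`;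
  **`tendstoInDistribution_replicaSpreadVar_of_nHit`** — `n · Σ_r (ȳ_r − ȳ̄)²/(R(R−1)) ⇒ Σ_r (Z_r − Z̄)²/(R(R−1))`.

NOT CLAIMED: the identification of the limit with `σ² χ²_{R−1}` or of the studentized ratio with
Student's `t_{R−1}` (the studentised statistic's limit law as a pushforward is
`NCMCGeneralSpaceReplicaTStatisticChains`); `R → ∞` asymptotics; anything numerical.
-/

namespace Summit.Ventures.LatticeQCDFlow.Exactness.GeneralNCMC

open MeasureTheory ProbabilityTheory Set Filter Finset Complex WithLp
open scoped ENNReal NNReal Topology RealInnerProductSpace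

/-! ## §3 Replica chains: the joint limit and the between-replica spread -/

section Chains

variable {S : Type*} [MeasurableSpace S]
  {κ : Kernel S S} [IsMarkovKernel κ] {π : Measure S} [IsProbabilityMeasure π]
  {ν : Measure S} [IsProbabilityMeasure ν] {ε : ℝ≥0∞} {m : ℕ}
  {ι : Type*} [Fintype ι] [Nonempty ι]

omit [Nonempty ι] in
/-- **THE REPLICA VECTOR IS ASYMPTOTICALLY A PRODUCT GAUSSIAN, EVERY FAMILY OF STARTS.**  `κ` Markov,
`π` invariant, `(nHit κ m)(z, ·) ≥ ε ν` (`ε ≠ 0`, `0 < m`), `|f| ≤ C`; independent replicas from ANY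
laws `μ r`.  Then `((√n)⁻¹ Σ_{t<n} (f(x^r_t) − πf))_r ⇒ N(0, σ²_f)^{⊗R}` in `EuclideanSpace ℝ ι`. -/
theorem tendstoInDistribution_replicaVector_of_nHit (hπ : Kernel.Invariant κ π) (hε : ε ≠ 0)
    (hmin : ∀ z, ε • ν ≤ nHit κ m z) (hm : 0 < m)
    {f : S → ℝ} (hf : Measurable f) {C : ℝ} (hC : ∀ x, |f x| ≤ C)
    (μ : ι → Measure S) [∀ r, IsProbabilityMeasure (μ r)]
    [∀ r, IsProbabilityMeasure (Kernel.trajMeasure (X := fun _ : ℕ => S) (μ r)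
        (fun n : ℕ => κ.comap (fun hh : (i : ↥(Finset.Iic n)) → S => hh ⟨n, Finset.mem_Iic.2 le_rfl⟩)
          (measurable_pi_apply _)))] :
    TendstoInDistribution (fun (n : ℕ) (x : ι → ℕ → S) =>
        toLp 2 (fun r => (Real.sqrt n)⁻¹ * ∑ t ∈ range n, (f (x r t) - ∫ z, f z ∂π)))
      atTop (toLp 2) (fun _ => Measure.pi fun r => Kernel.trajMeasure (X := fun _ : ℕ => S) (μ r)
        (fun n : ℕ => κ.comap (fun hh : (i : ↥(Finset.Iic n)) → S => hh ⟨n, Finset.mem_Iic.2 le_rfl⟩)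
          (measurable_pi_apply _)))
      (Measure.pi fun _ : ι => gaussianReal 0 (Real.toNNReal
        (Scoring.autocov κ π (fun y => f y - ∫ z, f z ∂π) 0
          + 2 * ∑' t, Scoring.autocov κ π (fun y => f y - ∫ z, f z ∂π) (t + 1)))) := by
  have hX : ∀ (_r : ι) (n : ℕ), Measurable fun x : ℕ → S =>
      (Real.sqrt n)⁻¹ * ∑ t ∈ range n, (f (x t) - ∫ z, f z ∂π) := fun _ n =>
    measurable_const.mul (Finset.measurable_sum _ fun t _ =>
      ((hf.comp (measurable_pi_apply t)).sub measurable_const))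
  exact tendstoInDistribution_pi_toLp
    (P := fun r => Kernel.trajMeasure (X := fun _ : ℕ => S) (μ r)
      (fun n : ℕ => κ.comap (fun hh : (i : ↥(Finset.Iic n)) → S => hh ⟨n, Finset.mem_Iic.2 le_rfl⟩)
        (measurable_pi_apply _)))
    (X := fun (_r : ι) (n : ℕ) (x : ℕ → S) => (Real.sqrt n)⁻¹ * ∑ t ∈ range n, (f (x t) - ∫ z, f z ∂π))
    hX (fun r => by
      -- one replica: GEN-19's CLT from the start `μ r`, variance in `Scoring.autocov` form, limit `id`
      have h := tendstoInDistribution_timeAverage_of_nHit hπ hε hmin hm hf hC (μ r)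
        (P' := gaussianReal 0 (Real.toNNReal ((∫ y, (f y - ∫ z, f z ∂π) ^ 2 ∂π)
          + 2 * ∑' k, ∫ y, (f y - ∫ z, f z ∂π)
            * (Scoring.kop κ)^[k + 1] (fun y => f y - ∫ z, f z ∂π) y ∂π))) (Y := id) HasLaw.id
      rw [cltVariance_eq_autocov κ π f] at h
      exact h)

/-- **THE BETWEEN-REPLICA SUM OF SQUARES HAS THE LIMIT LAW `Σ_r (Z_r − Z̄)²`, `Z ~ N(0, σ²_f)^{⊗R}`**:
with `ȳ_{r,n} = (Σ_{t<n} f(x^r_t))/n` and `ȳ̄_n = (Σ_r ȳ_{r,n})/R`,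
`n Σ_r (ȳ_{r,n} − ȳ̄_n)² ⇒ Σ_r (Z_r − Z̄)²` under the replica law, every family of starts. -/
theorem tendstoInDistribution_betweenReplicaSS_of_nHit (hπ : Kernel.Invariant κ π) (hε : ε ≠ 0)
    (hmin : ∀ z, ε • ν ≤ nHit κ m z) (hm : 0 < m)
    {f : S → ℝ} (hf : Measurable f) {C : ℝ} (hC : ∀ x, |f x| ≤ C)
    (μ : ι → Measure S) [∀ r, IsProbabilityMeasure (μ r)]
    [∀ r, IsProbabilityMeasure (Kernel.trajMeasure (X := fun _ : ℕ => S) (μ r)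
        (fun n : ℕ => κ.comap (fun hh : (i : ↥(Finset.Iic n)) → S => hh ⟨n, Finset.mem_Iic.2 le_rfl⟩)
          (measurable_pi_apply _)))] :
    TendstoInDistribution (fun (n : ℕ) (x : ι → ℕ → S) =>
        (n : ℝ) * ∑ r, ((∑ t ∈ range n, f (x r t)) / n
          - (∑ r', (∑ t ∈ range n, f (x r' t)) / n) / Fintype.card ι) ^ 2)
      atTop (fun z : ι → ℝ => ∑ r, (z r - (∑ r', z r') / Fintype.card ι) ^ 2)
      (fun _ => Measure.pi fun r => Kernel.trajMeasure (X := fun _ : ℕ => S) (μ r)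
        (fun n : ℕ => κ.comap (fun hh : (i : ↥(Finset.Iic n)) → S => hh ⟨n, Finset.mem_Iic.2 le_rfl⟩)
          (measurable_pi_apply _)))
      (Measure.pi fun _ : ι => gaussianReal 0 (Real.toNNReal
        (Scoring.autocov κ π (fun y => f y - ∫ z, f z ∂π) 0
          + 2 * ∑' t, Scoring.autocov κ π (fun y => f y - ∫ z, f z ∂π) (t + 1)))) := by
  have h := (tendstoInDistribution_replicaVector_of_nHit hπ hε hmin hm hf hC μ).continuous_comp
    continuous_sumSqDev
  have hR : (Fintype.card ι : ℝ) ≠ 0 := by exact_mod_cast (Fintype.card_ne_zero : Fintype.card ι ≠ 0)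
  refine h.congr (fun n => Eventually.of_forall fun x => ?_) (Eventually.of_forall fun z => ?_)
  · -- `Σ_r (V_r − V̄)² = n Σ_r (ȳ_r − ȳ̄)²` with `V_r = (√n)⁻¹ Σ_t (f − πf) = √n (ȳ_r − πf)`
    simp only [Function.comp_apply]
    have hV : ∀ r, (Real.sqrt n)⁻¹ * ∑ t ∈ range n, (f (x r t) - ∫ z, f z ∂π)
        = Real.sqrt n * ((∑ t ∈ range n, f (x r t)) / n - ∫ z, f z ∂π) := fun r =>
      (sqrt_mul_mean_sub_eq (fun t => f (x r t)) _ n).symm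
    simp_rw [hV]
    have hsqn : Real.sqrt n * Real.sqrt n = n := Real.mul_self_sqrt (Nat.cast_nonneg n)
    have hmean : (∑ r', Real.sqrt n * ((∑ t ∈ range n, f (x r' t)) / n - ∫ z, f z ∂π)) / Fintype.card ι
        = Real.sqrt n * ((∑ r', (∑ t ∈ range n, f (x r' t)) / n) / Fintype.card ι - ∫ z, f z ∂π) := by
      rw [← Finset.mul_sum, Finset.sum_sub_distrib, Finset.sum_const, Finset.card_univ, nsmul_eq_mul]
      field_simp
    rw [hmean, Finset.mul_sum]
    refine Finset.sum_congr rfl fun r _ => ?_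
    rw [← mul_sub, mul_pow, sq, hsqn]
    ring
  · simp only [Function.comp_apply]

/-- **THE SQUARED REPLICA STANDARD ERROR (DELETE-ONE JACKKNIFE VARIANCE OF THE POOLED MEAN) HAS A
RANDOM LIMIT AT FIXED `R`**: `n · Σ_r (ȳ_{r,n} − ȳ̄_n)²/(R(R − 1)) ⇒ Σ_r (Z_r − Z̄)²/(R(R − 1))`,
`Z ~ N(0, σ²_f)^{⊗R}`, under the replica law, every family of starts. -/
theorem tendstoInDistribution_replicaSpreadVar_of_nHit (hπ : Kernel.Invariant κ π) (hε : ε ≠ 0)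
    (hmin : ∀ z, ε • ν ≤ nHit κ m z) (hm : 0 < m)
    {f : S → ℝ} (hf : Measurable f) {C : ℝ} (hC : ∀ x, |f x| ≤ C)
    (μ : ι → Measure S) [∀ r, IsProbabilityMeasure (μ r)]
    [∀ r, IsProbabilityMeasure (Kernel.trajMeasure (X := fun _ : ℕ => S) (μ r)
        (fun n : ℕ => κ.comap (fun hh : (i : ↥(Finset.Iic n)) → S => hh ⟨n, Finset.mem_Iic.2 le_rfl⟩)
          (measurable_pi_apply _)))] :
    TendstoInDistribution (fun (n : ℕ) (x : ι → ℕ → S) =>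
        (n : ℝ) * ((∑ r, ((∑ t ∈ range n, f (x r t)) / n
          - (∑ r', (∑ t ∈ range n, f (x r' t)) / n) / Fintype.card ι) ^ 2)
            / ((Fintype.card ι : ℝ) * (Fintype.card ι - 1))))
      atTop (fun z : ι → ℝ => (∑ r, (z r - (∑ r', z r') / Fintype.card ι) ^ 2)
        / ((Fintype.card ι : ℝ) * (Fintype.card ι - 1)))
      (fun _ => Measure.pi fun r => Kernel.trajMeasure (X := fun _ : ℕ => S) (μ r)
        (fun n : ℕ => κ.comap (fun hh : (i : ↥(Finset.Iic n)) → S => hh ⟨n, Finset.mem_Iic.2 le_rfl⟩)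
          (measurable_pi_apply _)))
      (Measure.pi fun _ : ι => gaussianReal 0 (Real.toNNReal
        (Scoring.autocov κ π (fun y => f y - ∫ z, f z ∂π) 0
          + 2 * ∑' t, Scoring.autocov κ π (fun y => f y - ∫ z, f z ∂π) (t + 1)))) := by
  have h := (tendstoInDistribution_betweenReplicaSS_of_nHit hπ hε hmin hm hf hC μ).continuous_comp
    (g := fun v : ℝ => v / ((Fintype.card ι : ℝ) * (Fintype.card ι - 1))) (by fun_prop)
  refine h.congr (fun n => Eventually.of_forall fun x => ?_) (Eventually.of_forall fun z => ?_)
  · simp only [Function.comp_apply]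
    ring
  · simp only [Function.comp_apply]

end Chains

end Summit.Ventures.LatticeQCDFlow.Exactness.GeneralNCMC
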